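import Summits.Ventures.LatticeQCDFlow.Exactness.Phi4HMCPolyObsReversible
import Summits.Ventures.LatticeQCDFlow.Exactness.Phi4HMCActionCSD
import Summits.Ventures.LatticeQCDFlow.Exactness.Phi4HMCTrajectoryCSD
import HarnessLib

/-!
# The HMC floors for the ACTION ITSELF and the MAGNETISATION ITSELF (polynomial-envelope observables)

HONEST FRAMING: exact (Metropolis-corrected) sampling algorithms for lattice gauge theory;
figures of merit are autocorrelation/cost numbers at stated couplings and volumes; no
continuum-physics claim.  (SCALAR calibration rung S0-A: not a gauge result.)

Venture `LatticeQCDFlow` (cell pub-lqcd), topic `Exactness`; FANOUT row 2 (`s0-phi4`, HMC arm).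
NEW WORK of the cell: the floors of `Phi4HMCActionCSD` (action, every trajectory) and
`Phi4HMCOneStepCSD` (magnetisation, one step) run on the class `PolyObs`
(`Phi4HMCPolyObs`, `Phi4HMCPolyObsReversible`): the clip is removed.  Nothing is cited as a fact.

## What is proved

* `polyObs_sub_const`, `integral_hmcOpOf_sq_dev_eq_poly` (the integrated carré du champ through
  phase space on the class), **`hmc_tauInt_ge_of_msd_le_poly`** — `τ_int(f) ≥ 2 Var(f)/D − ½` for
  every `f ∈ PolyObs` whose mean squared accepted jump per update is `≤ D Z_p Z` (`λ > 0`, any `J`,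
  `Ψ` a measurable Lebesgue-preserving involution of polynomial growth);
* **`hmc_tauInt_ge_actionSelf`** (every involution of polynomial growth) and
  **`hmcPhi4_tauInt_ge_actionSelf`** — row 2's HMC (qpq leapfrog, EVERY `δ`, `N`), every `λ > 0`,
  real `J`, `g = S − ⟨S⟩` with summable autocorrelations and `ρ_g(1) < 1`:
  `τ_int,traj(S) ≥ Var(S)/(2(n+1) + 8e^{−2}) − ½` — the ACTION ITSELF (`≈ c_S/2 − ½`,
  `c_S = Var(S)/V`);
* **`hmcPhi4_oneStep_tauInt_ge_magnetisation`** — one-step HMC, every `δ`: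
  `τ_int(M) ≥ 2 Var(M)/((n+1)δ²) − ½ = 2χ/δ² − ½` — the MAGNETISATION ITSELF;
  **`hmcPhi4_traj_tauInt_ge_magnetisation`** — `N` steps, modulo a uniform bound `m̄` on the
  equilibrium total-momentum profile (`Phi4HMCTrajectoryCSD`): `τ_int,traj(M) ≥ 2χ/((Nδ)² m̄) − ½`.

NOT CLAIMED: `ρ_g(1) < 1` / summability for any run (hypotheses); any value of `c_S`, `χ`, or of the
momentum profile `m̄` for leapfrog.
-/

namespace Summit.Ventures.LatticeQCDFlow.Exactness

open Real MeasureTheory Filter Finset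
open Summit.Ventures.LatticeQCDFlow.Scoring

section Lattice

variable {n : ℕ}

/-- The class is closed under subtracting a constant (centring). -/
theorem polyObs_sub_const {f : (Fin (n + 1) → ℝ) → ℝ} (hf : PolyObs f) (c : ℝ) :
    PolyObs (fun φ => f φ - c) := by
  obtain ⟨hfm, B, k, hfb⟩ := hf
  refine ⟨hfm.sub measurable_const, |B| + |c|, k, fun φ => ?_⟩
  have e1 : 1 ≤ (1 + ∑ w, φ w ^ 2) ^ k := one_le_pow₀ (one_le_env φ)
  calc |f φ - c| ≤ |f φ| + |c| := abs_sub _ _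
    _ ≤ |B| * (1 + ∑ w, φ w ^ 2) ^ k + |c| * (1 + ∑ w, φ w ^ 2) ^ k :=
        add_le_add (abs_le_abs_mul_env hfb φ) (le_mul_of_one_le_right (abs_nonneg c) e1)
    _ = (|B| + |c|) * (1 + ∑ w, φ w ^ 2) ^ k := by ring

/-- **THE INTEGRATED CARRÉ DU CHAMP THROUGH PHASE SPACE on `PolyObs`**:
`∫ K[(g − g φ)²](φ) e^{−S} = Z_p⁻¹ ∫∫ a (g((Ψ z).1) − g(z.1))² e^{−H}` (coercive action, growth on `Ψ`). -/
theorem integral_hmcOpOf_sq_dev_eq_poly {J : Fin (n + 1) → Fin (n + 1) → ℝ} {lam ε K : ℝ}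
    (hε : 0 < ε) (hS : ∀ φ : Fin (n + 1) → ℝ, ε * ∑ w, φ w ^ 2 - K ≤ latticePhi4Action J lam φ)
    {Ψ : (Fin (n + 1) → ℝ) × (Fin (n + 1) → ℝ) → (Fin (n + 1) → ℝ) × (Fin (n + 1) → ℝ)}
    (hΨm : Measurable Ψ) (hΨμ : MeasurePreserving Ψ ((volume : Measure (Fin (n + 1) → ℝ)).prod volume)
      ((volume : Measure (Fin (n + 1) → ℝ)).prod volume))
    {g : (Fin (n + 1) → ℝ) → ℝ} (hg : PolyObs g) :
    ∫ φ, hmcOpOf J lam Ψ (fun ψ => (g ψ - g φ) ^ 2) φ * gibbsWeight J lam φ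
      = (∫ z, involAccept (phi4HmcEnergy J lam) Ψ z * (g (Ψ z).1 - g z.1) ^ 2
          * Real.exp (-phi4HmcEnergy J lam z)
            ∂((volume : Measure (Fin (n + 1) → ℝ)).prod volume)) / momentumZ n := by
  set H := phi4HmcEnergy J lam with hH
  set F : (Fin (n + 1) → ℝ) × (Fin (n + 1) → ℝ) → ℝ :=
    fun z => involAccept H Ψ z * (g (Ψ z).1 - g z.1) ^ 2 with hF
  have hHm : Measurable H := measurable_phi4HmcEnergy J lam
  have hW : ∀ φ p, Real.exp (-H (φ, p)) = gibbsWeight J lam φ * momentumWeight p :=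
    fun φ p => exp_neg_phi4HmcEnergy J lam (φ, p)
  -- integrability: `a (g' − g)² e^{−H} ≤ 2 g'² e^{−H∘Ψ} + 2 g² e^{−H}`
  have hg2 := integrable_sq_fst_mul_exp_neg hε hS hg
  have hg2Ψ : Integrable (fun z => g (Ψ z).1 ^ 2 * Real.exp (-H (Ψ z)))
      ((volume : Measure (Fin (n + 1) → ℝ)).prod volume) :=
    (hΨμ.integrable_comp hg2.aestronglyMeasurable).mpr hg2
  have hint : Integrable (fun z => F z * Real.exp (-H z))
      ((volume : Measure (Fin (n + 1) → ℝ)).prod volume) := by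
    have hR : Integrable (fun z => 2 * (g (Ψ z).1 ^ 2 * Real.exp (-H (Ψ z))
        + g z.1 ^ 2 * Real.exp (-phi4HmcEnergy J lam z)))
        ((volume : Measure (Fin (n + 1) → ℝ)).prod volume) := (hg2Ψ.add hg2).const_mul 2
    refine Integrable.mono' hR
      ((((measurable_involAccept hHm hΨm).mul
        (((hg.1.comp (measurable_fst.comp hΨm)).sub (hg.1.comp measurable_fst)).pow_const 2)).mul
        (Real.measurable_exp.comp hHm.neg)).aestronglyMeasurable)
      (Eventually.of_forall fun z => ?_)
    have ha0 := involAccept_nonneg H Ψ z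
    have ha1 := involAccept_le_one H Ψ z
    have hw0 : 0 ≤ Real.exp (-H z) := (Real.exp_pos _).le
    have hdom := involAccept_mul_exp_neg_le H Ψ z
    rw [Real.norm_eq_abs, hF, abs_of_nonneg (mul_nonneg (mul_nonneg ha0 (sq_nonneg _)) hw0)]
    have hsq : (g (Ψ z).1 - g z.1) ^ 2 ≤ 2 * g (Ψ z).1 ^ 2 + 2 * g z.1 ^ 2 := by
      nlinarith [sq_nonneg (g (Ψ z).1 + g z.1)]
    have h1 : g (Ψ z).1 ^ 2 * (involAccept H Ψ z * Real.exp (-H z))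
        ≤ g (Ψ z).1 ^ 2 * Real.exp (-H (Ψ z)) := mul_le_mul_of_nonneg_left hdom (sq_nonneg _)
    have h2 : g z.1 ^ 2 * (involAccept H Ψ z * Real.exp (-H z)) ≤ g z.1 ^ 2 * Real.exp (-H z) := by
      calc g z.1 ^ 2 * (involAccept H Ψ z * Real.exp (-H z)) ≤ g z.1 ^ 2 * (1 * Real.exp (-H z)) :=
            mul_le_mul_of_nonneg_left (mul_le_mul_of_nonneg_right ha1 hw0) (sq_nonneg _)
        _ = g z.1 ^ 2 * Real.exp (-H z) := by rw [one_mul]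
    have haw : 0 ≤ involAccept H Ψ z * Real.exp (-H z) := mul_nonneg ha0 hw0
    nlinarith [mul_le_mul_of_nonneg_right hsq haw]
  have hop : ∀ φ, hmcOpOf J lam Ψ (fun ψ => (g ψ - g φ) ^ 2) φ
      = (∫ p, F (φ, p) * momentumWeight p) / momentumZ n := fun φ => by
    rw [hmcOpOf_sq_dev_eq]
  have hfub : ∫ φ, (∫ p, F (φ, p) * momentumWeight p) * gibbsWeight J lam φ
      = ∫ z, F z * Real.exp (-H z) ∂((volume : Measure (Fin (n + 1) → ℝ)).prod volume) := by
    rw [integral_prod _ hint]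
    refine integral_congr_ae (Eventually.of_forall fun φ => ?_)
    dsimp only
    rw [← integral_mul_const]
    refine integral_congr_ae (Eventually.of_forall fun p => ?_)
    dsimp only
    rw [hW φ p]
    ring
  calc ∫ φ, hmcOpOf J lam Ψ (fun ψ => (g ψ - g φ) ^ 2) φ * gibbsWeight J lam φ
      = ∫ φ, ((∫ p, F (φ, p) * momentumWeight p) * gibbsWeight J lam φ) / momentumZ n := by
        refine integral_congr_ae (Eventually.of_forall fun φ => ?_)
        dsimp only
        rw [hop]
        ring
    _ = (∫ z, F z * Real.exp (-H z)
          ∂((volume : Measure (Fin (n + 1) → ℝ)).prod volume)) / momentumZ n := by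
        rw [integral_div, hfub]

/-- **THE MEAN-SQUARED-JUMP FLOOR ON `PolyObs`.**  Every `λ > 0`, real `J`, measurable
Lebesgue-preserving involution `Ψ` of polynomial growth; `f ∈ PolyObs`, `g = f − ⟨f⟩`.  If
`∫∫ a (f((Ψ z).1) − f(z.1))² e^{−H} ≤ D · Z_p · Z` and the autocorrelation series of `g` is summable
with `ρ_g(1) < 1`, then `τ_int(f) ≥ 2 ⟨(f − ⟨f⟩)²⟩/D − ½`. -/
theorem hmc_tauInt_ge_of_msd_le_poly {lam : ℝ} (hlam : 0 < lam) (J : Fin (n + 1) → Fin (n + 1) → ℝ)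
    {Ψ : (Fin (n + 1) → ℝ) × (Fin (n + 1) → ℝ) → (Fin (n + 1) → ℝ) × (Fin (n + 1) → ℝ)}
    (hΨm : Measurable Ψ) (hΨi : Function.Involutive Ψ)
    (hΨμ : MeasurePreserving Ψ ((volume : Measure (Fin (n + 1) → ℝ)).prod volume)
      ((volume : Measure (Fin (n + 1) → ℝ)).prod volume))
    {C : ℝ} {m : ℕ} (hC : 0 ≤ C) (hΨg : ∀ z, phaseSize (Ψ z) ≤ C * phaseSize z ^ m)
    {f : (Fin (n + 1) → ℝ) → ℝ} (hf : PolyObs f) {D : ℝ}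
    (hD : ∫ z, involAccept (phi4HmcEnergy J lam) Ψ z * (f (Ψ z).1 - f z.1) ^ 2
        * Real.exp (-phi4HmcEnergy J lam z) ∂((volume : Measure (Fin (n + 1) → ℝ)).prod volume)
        ≤ D * (momentumZ n * gibbsZ J lam))
    (hs : Summable fun k => (∫ φ, (f φ - gibbsExpect J lam f)
        * ((hmcOpOf J lam Ψ)^[k + 1] (fun ψ => f ψ - gibbsExpect J lam f)) φ * gibbsWeight J lam φ)
        / ∫ φ, (f φ - gibbsExpect J lam f) ^ 2 * gibbsWeight J lam φ)
    (hρ : (∫ φ, (f φ - gibbsExpect J lam f)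
        * hmcOpOf J lam Ψ (fun ψ => f ψ - gibbsExpect J lam f) φ * gibbsWeight J lam φ)
        / (∫ φ, (f φ - gibbsExpect J lam f) ^ 2 * gibbsWeight J lam φ) < 1) :
    2 * gibbsExpect J lam (fun φ => (f φ - gibbsExpect J lam f) ^ 2) / D - 1 / 2
      ≤ tauInt (fun k => (∫ φ, (f φ - gibbsExpect J lam f)
          * ((hmcOpOf J lam Ψ)^[k] (fun ψ => f ψ - gibbsExpect J lam f)) φ * gibbsWeight J lam φ)
          / ∫ φ, (f φ - gibbsExpect J lam f) ^ 2 * gibbsWeight J lam φ) := by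
  have hco := latticePhi4Action_coercive hlam J
  have hZ := gibbsZ_pos hlam J
  have hZp := momentumZ_pos n
  have hg : PolyObs (fun ψ => f ψ - gibbsExpect J lam f) := polyObs_sub_const hf _
  have hΓ : ∫ φ, hmcOpOf J lam Ψ (fun ψ => ((f ψ - gibbsExpect J lam f)
      - (f φ - gibbsExpect J lam f)) ^ 2) φ * gibbsWeight J lam φ ≤ D * gibbsZ J lam := by
    rw [integral_hmcOpOf_sq_dev_eq_poly one_pos hco hΨm hΨμ hg]
    have e : ∀ z : (Fin (n + 1) → ℝ) × (Fin (n + 1) → ℝ),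
        involAccept (phi4HmcEnergy J lam) Ψ z * ((f (Ψ z).1 - gibbsExpect J lam f)
          - (f z.1 - gibbsExpect J lam f)) ^ 2 * Real.exp (-phi4HmcEnergy J lam z)
        = involAccept (phi4HmcEnergy J lam) Ψ z * (f (Ψ z).1 - f z.1) ^ 2
          * Real.exp (-phi4HmcEnergy J lam z) := fun z => by ring
    simp_rw [e]
    rw [div_le_iff₀ hZp]
    calc _ ≤ D * (momentumZ n * gibbsZ J lam) := hD
      _ = D * gibbsZ J lam * momentumZ n := by ring
  have hfloor := RevOp.tauInt_ge_of_integral_carre_le (μ := volume) (A := PolyObs)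
    (K := hmcOpOf J lam Ψ) (w := gibbsWeight J lam)
    (fun φ => (gibbsWeight_pos J lam φ).le) (polyObs_const 1)
    (fun f h hf hh => polyObs_integrable_mul_mul_gibbsWeight one_pos hco hf hh)
    (fun f h c hf hh => polyObs_add_mul hf hh c)
    (fun f hf => polyObs_hmcOpOf J lam hΨm hC hΨg hf)
    (fun f h c hf hh x => hmcOpOf_add_mul_poly J lam hΨm hC hΨg hf hh c x)
    (fun f h hf hh => hmc_reversible_poly one_pos hco hΨm hΨi hΨμ hf hh)
    (fun f hf => hmcOpOf_contraction_poly one_pos hco hΨm hΨi hΨμ hC hΨg hf)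
    (fun φ => hmcOpOf_one J lam Ψ φ) hg (polyObs_sq hg) hΓ hs hρ
  have e : ∀ P : ℝ, 2 * (P / gibbsZ J lam) / D - 1 / 2 = 2 * P / (D * gibbsZ J lam) - 1 / 2 := by
    intro P
    rw [mul_div_assoc, div_div, mul_comm (gibbsZ J lam) D, ← mul_div_assoc]
  unfold gibbsExpect
  exact (e _).le.trans hfloor

/-- **THE ACTION FLOOR FOR THE ACTION ITSELF, EVERY HMC-TYPE UPDATE OF POLYNOMIAL GROWTH** — every
`λ > 0`, real `J`, every measurable Lebesgue-preserving involution `Ψ` with `s(Ψ z) ≤ C s(z)^m`;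
`g = S − ⟨S⟩`: summable autocorrelations with `ρ_g(1) < 1` ⇒
`τ_int(S) ≥ Var(S)/(2(n+1) + 8e^{−2}) − ½` per update. -/
theorem hmc_tauInt_ge_actionSelf {lam : ℝ} (hlam : 0 < lam) (J : Fin (n + 1) → Fin (n + 1) → ℝ)
    {Ψ : (Fin (n + 1) → ℝ) × (Fin (n + 1) → ℝ) → (Fin (n + 1) → ℝ) × (Fin (n + 1) → ℝ)}
    (hΨm : Measurable Ψ) (hΨi : Function.Involutive Ψ)
    (hΨμ : MeasurePreserving Ψ ((volume : Measure (Fin (n + 1) → ℝ)).prod volume)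
      ((volume : Measure (Fin (n + 1) → ℝ)).prod volume))
    {C : ℝ} {m : ℕ} (hC : 0 ≤ C) (hΨg : ∀ z, phaseSize (Ψ z) ≤ C * phaseSize z ^ m)
    (hs : Summable fun k => (∫ φ, (latticePhi4Action J lam φ - gibbsExpect J lam (latticePhi4Action J lam))
        * ((hmcOpOf J lam Ψ)^[k + 1]
            (fun ψ => latticePhi4Action J lam ψ - gibbsExpect J lam (latticePhi4Action J lam))) φ
        * gibbsWeight J lam φ)
        / ∫ φ, (latticePhi4Action J lam φ - gibbsExpect J lam (latticePhi4Action J lam)) ^ 2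
          * gibbsWeight J lam φ)
    (hρ : (∫ φ, (latticePhi4Action J lam φ - gibbsExpect J lam (latticePhi4Action J lam))
        * hmcOpOf J lam Ψ
            (fun ψ => latticePhi4Action J lam ψ - gibbsExpect J lam (latticePhi4Action J lam)) φ
        * gibbsWeight J lam φ)
        / (∫ φ, (latticePhi4Action J lam φ - gibbsExpect J lam (latticePhi4Action J lam)) ^ 2
          * gibbsWeight J lam φ) < 1) :
    gibbsExpect J lam (fun φ =>
        (latticePhi4Action J lam φ - gibbsExpect J lam (latticePhi4Action J lam)) ^ 2)
        / (2 * ((n : ℝ) + 1) + 8 * Real.exp (-2)) - 1 / 2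
      ≤ tauInt (fun k => (∫ φ, (latticePhi4Action J lam φ - gibbsExpect J lam (latticePhi4Action J lam))
        * ((hmcOpOf J lam Ψ)^[k]
            (fun ψ => latticePhi4Action J lam ψ - gibbsExpect J lam (latticePhi4Action J lam))) φ
        * gibbsWeight J lam φ)
        / ∫ φ, (latticePhi4Action J lam φ - gibbsExpect J lam (latticePhi4Action J lam)) ^ 2
          * gibbsWeight J lam φ) := by
  have hD := hmc_action_msd_le one_pos (latticePhi4Action_coercive hlam J) hΨm hΨi hΨμ
    (f := latticePhi4Action J lam) (fun _ _ => le_rfl)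
  have h := hmc_tauInt_ge_of_msd_le_poly hlam J hΨm hΨi hΨμ hC hΨg (polyObs_action J lam) hD hs hρ
  rw [action_floor_transfer] at h
  exact h

/-- **THE HMC ACTION FLOOR FOR THE ACTION ITSELF** — row 2's HMC (qpq leapfrog), every `λ > 0`,
every real `J`, EVERY step size `δ` and trajectory length `N`; `g = S − ⟨S⟩`: summable
autocorrelations with `ρ_g(1) < 1` ⇒ `τ_int,traj(S) ≥ Var(S)/(2(n+1) + 8e^{−2}) − ½`. -/
theorem hmcPhi4_tauInt_ge_actionSelf {lam : ℝ} (hlam : 0 < lam) (J : Fin (n + 1) → Fin (n + 1) → ℝ)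
    (δ : ℝ) (N : ℕ)
    (hs : Summable fun k => (∫ φ, (latticePhi4Action J lam φ - gibbsExpect J lam (latticePhi4Action J lam))
        * ((hmcOpPhi4 J lam δ N)^[k + 1]
            (fun ψ => latticePhi4Action J lam ψ - gibbsExpect J lam (latticePhi4Action J lam))) φ
        * gibbsWeight J lam φ)
        / ∫ φ, (latticePhi4Action J lam φ - gibbsExpect J lam (latticePhi4Action J lam)) ^ 2
          * gibbsWeight J lam φ)
    (hρ : (∫ φ, (latticePhi4Action J lam φ - gibbsExpect J lam (latticePhi4Action J lam))
        * hmcOpPhi4 J lam δ N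
            (fun ψ => latticePhi4Action J lam ψ - gibbsExpect J lam (latticePhi4Action J lam)) φ
        * gibbsWeight J lam φ)
        / (∫ φ, (latticePhi4Action J lam φ - gibbsExpect J lam (latticePhi4Action J lam)) ^ 2
          * gibbsWeight J lam φ) < 1) :
    gibbsExpect J lam (fun φ =>
        (latticePhi4Action J lam φ - gibbsExpect J lam (latticePhi4Action J lam)) ^ 2)
        / (2 * ((n : ℝ) + 1) + 8 * Real.exp (-2)) - 1 / 2
      ≤ tauInt (fun k => (∫ φ, (latticePhi4Action J lam φ - gibbsExpect J lam (latticePhi4Action J lam))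
        * ((hmcOpPhi4 J lam δ N)^[k]
            (fun ψ => latticePhi4Action J lam ψ - gibbsExpect J lam (latticePhi4Action J lam))) φ
        * gibbsWeight J lam φ)
        / ∫ φ, (latticePhi4Action J lam φ - gibbsExpect J lam (latticePhi4Action J lam)) ^ 2
          * gibbsWeight J lam φ) := by
  obtain ⟨C, hC1, hCg⟩ := hmcProposal_growth J lam δ N
  exact hmc_tauInt_ge_actionSelf hlam J (measurable_hmcProposal J lam δ N)
    (hmcProposal_involutive J lam δ N) (measurePreserving_hmcProposal J lam δ N)
    (zero_le_one.trans hC1) hCg hs hρ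

/-- **THE ONE-STEP HMC FLOOR FOR THE MAGNETISATION ITSELF** — row 2's HMC with `N = 1` (qpq),
every `λ > 0`, every real `J`, every step size `δ`; `g = M − ⟨M⟩`, `M = Σ_x φ_x`: summable
autocorrelations with `ρ_g(1) < 1` ⇒ `τ_int(M) ≥ 2 Var(M)/((n+1) δ²) − ½` (`= 2χ/δ² − ½`). -/
theorem hmcPhi4_oneStep_tauInt_ge_magnetisation {lam : ℝ} (hlam : 0 < lam)
    (J : Fin (n + 1) → Fin (n + 1) → ℝ) (δ : ℝ)
    (hs : Summable fun k => (∫ φ, ((∑ x, φ x) - gibbsExpect J lam (fun ψ => ∑ x, ψ x))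
        * ((hmcOpPhi4 J lam δ 1)^[k + 1]
            (fun ψ => (∑ x, ψ x) - gibbsExpect J lam (fun ψ => ∑ x, ψ x))) φ * gibbsWeight J lam φ)
        / ∫ φ, ((∑ x, φ x) - gibbsExpect J lam (fun ψ => ∑ x, ψ x)) ^ 2 * gibbsWeight J lam φ)
    (hρ : (∫ φ, ((∑ x, φ x) - gibbsExpect J lam (fun ψ => ∑ x, ψ x))
        * hmcOpPhi4 J lam δ 1 (fun ψ => (∑ x, ψ x) - gibbsExpect J lam (fun ψ => ∑ x, ψ x)) φ
        * gibbsWeight J lam φ)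
        / (∫ φ, ((∑ x, φ x) - gibbsExpect J lam (fun ψ => ∑ x, ψ x)) ^ 2 * gibbsWeight J lam φ) < 1) :
    2 * gibbsExpect J lam (fun φ => ((∑ x, φ x) - gibbsExpect J lam (fun ψ => ∑ x, ψ x)) ^ 2)
        / (((n : ℝ) + 1) * δ ^ 2) - 1 / 2
      ≤ tauInt (fun k => (∫ φ, ((∑ x, φ x) - gibbsExpect J lam (fun ψ => ∑ x, ψ x))
        * ((hmcOpPhi4 J lam δ 1)^[k]
            (fun ψ => (∑ x, ψ x) - gibbsExpect J lam (fun ψ => ∑ x, ψ x))) φ * gibbsWeight J lam φ)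
        / ∫ φ, ((∑ x, φ x) - gibbsExpect J lam (fun ψ => ∑ x, ψ x)) ^ 2 * gibbsWeight J lam φ) := by
  obtain ⟨C, hC1, hCg⟩ := hmcProposal_growth J lam δ 1
  have hΨm := measurable_hmcProposal (Λ := Fin (n + 1)) J lam δ 1
  have hΨi := hmcProposal_involutive (Λ := Fin (n + 1)) J lam δ 1
  have hΨμ := measurePreserving_hmcProposal (Λ := Fin (n + 1)) J lam δ 1
  have hD := hmc_oneStep_msd_le one_pos (latticePhi4Action_coercive hlam J) δ
    (f := fun φ : Fin (n + 1) → ℝ => ∑ x, φ x) (fun _ _ => le_rfl)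
  exact hmc_tauInt_ge_of_msd_le_poly hlam J hΨm hΨi hΨμ (zero_le_one.trans hC1) hCg
    polyObs_magnetisation hD hs hρ

/-- **THE N-STEP FLOOR FOR THE MAGNETISATION ITSELF, MODULO THE MOMENTUM PROFILE** — row 2's HMC
(qpq, every `δ`, `N`), every `λ > 0`, real `J`; uniform profile bound
`∫∫ P((L^k z).2)² e^{−H} ≤ m̄ V Z_p Z` for `k ≤ N` (`m̄ = 1` for an `e^{−H}`-preserving integrator);
`g = M − ⟨M⟩`: summable autocorrelations with `ρ_g(1) < 1` ⇒
`τ_int,traj(M) ≥ 2 Var(M)/((n+1)(Nδ)² m̄) − ½ = 2χ/(T² m̄) − ½`. -/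
theorem hmcPhi4_traj_tauInt_ge_magnetisation {lam : ℝ} (hlam : 0 < lam)
    (J : Fin (n + 1) → Fin (n + 1) → ℝ) (δ : ℝ) (N : ℕ) {mbar : ℝ}
    (hm : ∀ k ≤ N, ∫ z : (Fin (n + 1) → ℝ) × (Fin (n + 1) → ℝ),
        (∑ x, ((leapfrogQPQ J lam δ)^[k] z).2 x) ^ 2 * Real.exp (-phi4HmcEnergy J lam z)
          ∂((volume : Measure (Fin (n + 1) → ℝ)).prod volume)
        ≤ mbar * (((n : ℝ) + 1) * (momentumZ n * gibbsZ J lam)))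
    (hs : Summable fun k => (∫ φ, ((∑ x, φ x) - gibbsExpect J lam (fun ψ => ∑ x, ψ x))
        * ((hmcOpPhi4 J lam δ N)^[k + 1]
            (fun ψ => (∑ x, ψ x) - gibbsExpect J lam (fun ψ => ∑ x, ψ x))) φ * gibbsWeight J lam φ)
        / ∫ φ, ((∑ x, φ x) - gibbsExpect J lam (fun ψ => ∑ x, ψ x)) ^ 2 * gibbsWeight J lam φ)
    (hρ : (∫ φ, ((∑ x, φ x) - gibbsExpect J lam (fun ψ => ∑ x, ψ x))
        * hmcOpPhi4 J lam δ N (fun ψ => (∑ x, ψ x) - gibbsExpect J lam (fun ψ => ∑ x, ψ x)) φ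
        * gibbsWeight J lam φ)
        / (∫ φ, ((∑ x, φ x) - gibbsExpect J lam (fun ψ => ∑ x, ψ x)) ^ 2 * gibbsWeight J lam φ) < 1) :
    2 * gibbsExpect J lam (fun φ => ((∑ x, φ x) - gibbsExpect J lam (fun ψ => ∑ x, ψ x)) ^ 2)
        / (((n : ℝ) + 1) * ((N : ℝ) * δ) ^ 2 * mbar) - 1 / 2
      ≤ tauInt (fun k => (∫ φ, ((∑ x, φ x) - gibbsExpect J lam (fun ψ => ∑ x, ψ x))
        * ((hmcOpPhi4 J lam δ N)^[k]
            (fun ψ => (∑ x, ψ x) - gibbsExpect J lam (fun ψ => ∑ x, ψ x))) φ * gibbsWeight J lam φ)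
        / ∫ φ, ((∑ x, φ x) - gibbsExpect J lam (fun ψ => ∑ x, ψ x)) ^ 2 * gibbsWeight J lam φ) := by
  obtain ⟨C, hC1, hCg⟩ := hmcProposal_growth J lam δ N
  have hmsd := hmc_traj_msd_le one_pos (latticePhi4Action_coercive hlam J) δ N
    (m := fun _ => mbar) (fun k hk => hm k hk) (f := fun φ : Fin (n + 1) → ℝ => ∑ x, φ x)
    (fun _ _ => le_rfl)
  have e : δ ^ 2 * N * ((n : ℝ) + 1) / 2 * (∑ k ∈ Finset.range N, (mbar + mbar))
      = ((n : ℝ) + 1) * ((N : ℝ) * δ) ^ 2 * mbar := by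
    rw [Finset.sum_const, Finset.card_range, nsmul_eq_mul]
    ring
  rw [e] at hmsd
  exact hmc_tauInt_ge_of_msd_le_poly hlam J (measurable_hmcProposal J lam δ N)
    (hmcProposal_involutive J lam δ N) (measurePreserving_hmcProposal J lam δ N)
    (zero_le_one.trans hC1) hCg polyObs_magnetisation hmsd hs hρ

end Lattice

end Summit.Ventures.LatticeQCDFlow.Exactness
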